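import Summits.ResolutionOfSingularities.ResolutionOfSingularities.Theorems.RadicialJungCleanModelsSufficeGameRoundOff
import Summits.ResolutionOfSingularities.ResolutionOfSingularities.Theorems.RadicialJungCleanModelsSufficeChartsKN
import Summits.ResolutionOfSingularities.ResolutionOfSingularities.Theorems.RadicialJungCleanModelsSufficeOneCharged

/-!
# Route `RadicialJung`, crux `CleanModelsSuffice`, line `Sketch`: the END STATE of the game at
# one point — the toroidal locus; regular points

Helper for the registered stub `stub_gameEndResolves` of the skeleton of
`Summit.ResolutionOfSingularities.ResolutionOfSingularities.Theses.RadicialJung.CleanModelsSuffice`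
(stmt-ResolutionOfSingularities-15883). Let `S : GameState p V₀ L V π` be a game state in the END
STATE (`S.EndCond`: at most one old charged component through any point, and none where an
exceptional divisor is charged), with `L` also a `K(V)`-algebra compatibly with `π^♯` (the standing
hypotheses are bundled as the record `S.EndHyp`). This file reads the state at ONE point `v`:

* the presentation in `L` over `𝒪_{V,v}`: `y_v ∉ K(V)`, `y_v^p = w_v ∏ u_i^{a_i}` (`y_pow_stalk`);
* the TOROIDAL LOCUS `S.tor = {v | some exceptional divisor is charged at v}`: in the end state a
  toroidal point has `mOld = 0` and all its charged coordinates are labels; off the toroidal locus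
  at most one coordinate is charged, and it is not a label;
* `isRegularLocalRing_integralClosure_of_not_mem_tor` — **off the toroidal locus
  `integralClosure 𝒪_{V,v} L` is a regular local ring** (wound / transversal regular type by
  `S.reg`, or one charged parameter, `isRegularLocalRing_integralClosure_of_one_charged`).
-/

noncomputable section

set_option linter.dupNamespace false -- mandated namespace of this single-conjunct summit

open CategoryTheory AlgebraicGeometry TopologicalSpace IsLocalRing
open Literature.AlgebraicGeometry.Resolution Literature.AlgebraicGeometry.Motives

namespace Summit.ResolutionOfSingularities.ResolutionOfSingularities.Theorems.RadicialJung.CleanModelsSuffice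

attribute [local instance] stalkAlgebra isScalarTower_stalkAlgebra

namespace GameState

variable {p : ℕ} {V₀ : Scheme.{0}} [IsIntegral V₀] {L : Type} [Field L] [Algebra V₀.functionField L]
  {V : Scheme.{0}} [IsIntegral V] {π : V ⟶ V₀} [IsDominant π] (S : GameState p V₀ L V π)

/-! ## The standing hypotheses of the end state -/

/-- **Standing hypotheses at the end of the game**: `p` prime, `K(V)` of characteristic `p`,
`[L : K(V)] = p` for a `K(V)`-algebra structure on `L` compatible with `π^♯ : K(V₀) ≅ K(V)`, `V`
locally Noetherian, and the end condition. [folklore] -/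
structure EndHyp (S : GameState p V₀ L V π) [Algebra V.functionField L] : Type where
  prime : p.Prime
  charP : CharP V.functionField p
  finrank : Module.finrank V.functionField L = p
  compat : ∀ g, algebraMap V.functionField L (RatFn.functionFieldMap π g) =
    algebraMap V₀.functionField L g
  surj : Function.Surjective (RatFn.functionFieldMap π)
  locallyNoetherian : IsLocallyNoetherian V
  endCond : S.EndCond

/-! ## Measures at a point -/

/-- The TOROIDAL LOCUS: points where some exceptional divisor is charged. [folklore] -/
def tor (S : GameState p V₀ L V π) : Set V :=
  {v | ∃ D, S.chargedAt D v}

/-- A coordinate is charged iff its exponent is nonzero. [folklore] -/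
theorem mem_ch_iff (v : V) (i : Fin (S.d v)) : i ∈ S.ch v ↔ S.a v i ≠ 0 := by
  simp [ch]

/-- `D` is charged at `v` iff it is a member of `E` through `v` whose label has nonzero exponent.
[folklore] -/
theorem chargedAt_iff (D : V.IdealSheafData) (v : V) :
    S.chargedAt D v ↔ ∃ h : D ∈ S.E ∧ v ∈ D.support, S.a v (S.lab v ⟨D, h⟩) ≠ 0 := by
  unfold chargedAt expOf
  by_cases h : D ∈ S.E ∧ v ∈ D.support
  · simp [h]
  · simp [h]

/-- A charged label makes the point toroidal. [folklore] -/
theorem mem_tor_of_isLab {v : V} {i : Fin (S.d v)} (hi : S.IsLab v i) (ha : S.a v i ≠ 0) :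
    v ∈ S.tor := by
  obtain ⟨D, rfl⟩ := hi
  exact ⟨D.1, (S.chargedAt_iff D.1 v).mpr ⟨D.2, ha⟩⟩

/-- In the end state a toroidal point has no old charged component. [folklore] -/
theorem mOld_eq_zero_of_mem_tor (hend : S.EndCond) {v : V} (hv : v ∈ S.tor) : S.mOld v = 0 := by
  obtain ⟨h1, h2⟩ := hend v
  obtain ⟨D, hD⟩ := hv
  by_contra h
  exact h2 (le_antisymm h1 (Nat.one_le_iff_ne_zero.mpr h)) D hD

/-- In the end state every charged coordinate of a toroidal point is a label. [folklore] -/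
theorem isLab_of_mem_ch (hend : S.EndCond) {v : V} (hv : v ∈ S.tor) {i : Fin (S.d v)}
    (hi : i ∈ S.ch v) : S.IsLab v i := by
  classical
  by_contra h
  have hmem : i ∈ S.oldCh v := Finset.mem_filter.mpr ⟨hi, h⟩
  have h0 := S.mOld_eq_zero_of_mem_tor hend hv
  rw [mOld, Finset.card_eq_zero] at h0
  rw [h0] at hmem
  exact (Finset.notMem_empty i hmem)

/-- Off the toroidal locus, labels are uncharged. [folklore] -/
theorem a_eq_zero_of_isLab {v : V} (hv : v ∉ S.tor) {i : Fin (S.d v)} (hi : S.IsLab v i) :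
    S.a v i = 0 := by
  by_contra h
  exact hv (S.mem_tor_of_isLab hi h)

/-- Off the toroidal locus, in the end state, at most one coordinate is charged, and it is not a
label. [folklore] -/
theorem ch_subset_of_not_mem_tor (hend : S.EndCond) {v : V} (hv : v ∉ S.tor) :
    (∀ i, S.a v i = 0) ∨ ∃ i₀, S.a v i₀ ≠ 0 ∧ ∀ i, i ≠ i₀ → S.a v i = 0 := by
  classical
  have hold : S.oldCh v = S.ch v := by
    refine Finset.filter_true_of_mem fun i hi => ?_
    intro hl
    exact (S.mem_ch_iff v i).mp hi (S.a_eq_zero_of_isLab hv hl)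
  have hcard : (S.ch v).card ≤ 1 := by rw [← hold]; exact (hend v).1
  by_cases h0 : (S.ch v).card = 0
  · left
    intro i
    by_contra h
    rw [Finset.card_eq_zero] at h0
    have := (S.mem_ch_iff v i).mpr h
    rw [h0] at this
    exact Finset.notMem_empty i this
  · right
    have h1 : (S.ch v).card = 1 := le_antisymm hcard (Nat.one_le_iff_ne_zero.mpr h0)
    obtain ⟨i₀, hi₀⟩ := Finset.card_eq_one.mp h1
    refine ⟨i₀, (S.mem_ch_iff v i₀).mp (by rw [hi₀]; exact Finset.mem_singleton_self _),
      fun i hi => ?_⟩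
    by_contra h
    have := (S.mem_ch_iff v i).mpr h
    rw [hi₀, Finset.mem_singleton] at this
    exact hi this

/-! ## The presentation in `L` over `𝒪_{V,v}` -/

section Presentation

variable [Algebra V.functionField L]

/-- `y_v ∉ K(V)`. [folklore] -/
theorem y_not_mem_range (H : S.EndHyp) (v : V) :
    S.y v ∉ Set.range (algebraMap V.functionField L) := by
  rintro ⟨z, hz⟩
  obtain ⟨g, rfl⟩ := H.surj z
  exact S.y_not_mem v ⟨g, by rw [← H.compat g, hz]⟩

/-- `y_v ≠ 0`. [folklore] -/
theorem y_ne_zero (H : S.EndHyp) (v : V) : S.y v ≠ 0 := fun h =>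
  S.y_not_mem_range H v ⟨0, by rw [map_zero, h]⟩

/-- **`y_v^p = w_v ∏ u_i^{a_i}` through `𝒪_{V,v} → L`.** [folklore] -/
theorem y_pow_stalk (H : S.EndHyp) (v : V) :
    S.y v ^ p = algebraMap (V.presheaf.stalk v) L (S.w v * ∏ i, S.u v i ^ S.a v i) := by
  rw [← S.y_pow v, ← H.compat, S.map_g v]
  rfl

/-- `CharP` for the stalks and for `L`. [folklore] -/
theorem charP_stalk (H : S.EndHyp) (v : V) : CharP (V.presheaf.stalk v) p :=
  haveI := H.charP
  RingHom.charP (algebraMap (V.presheaf.stalk v) V.functionField) (IsFractionRing.injective _ _) p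

/-- `L` has characteristic `p`. [folklore] -/
theorem charP_L (H : S.EndHyp) : CharP L p :=
  haveI := H.charP
  charP_of_injective_ringHom (algebraMap V.functionField L).injective p

/-! ## Regular points: `v ∉ S.tor` -/

/-- **Off the toroidal locus the integral closure is a regular local ring** (end state): either no
coordinate is charged (wound or transversal regular type, `S.reg`) or exactly one, not a label
(`isRegularLocalRing_integralClosure_of_one_charged`). [folklore] -/
theorem isRegularLocalRing_integralClosure_of_not_mem_tor (H : S.EndHyp) {v : V} (hv : v ∉ S.tor) :
    IsRegularLocalRing (integralClosure (V.presheaf.stalk v) L) := by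
  haveI := S.isRegular v
  haveI := H.charP
  haveI := S.charP_stalk H v
  haveI := S.charP_L H
  haveI : FiniteDimensional V.functionField L :=
    Module.finite_of_finrank_pos (by rw [H.finrank]; exact H.prime.pos)
  have hyp := S.y_pow_stalk H v
  rcases S.ch_subset_of_not_mem_tor H.endCond hv with h0 | ⟨i₀, hi₀, hrest⟩
  · have h1 : ∏ i, S.u v i ^ S.a v i = 1 := Finset.prod_eq_one fun i _ => by rw [h0 i, pow_zero]
    rw [h1, mul_one] at hyp
    rcases S.reg v h0 with hw | ⟨c, hc1, hc2⟩
    · exact CleanResolves.isRegularLocalRing_integralClosure_of_wound (K := V.functionField) H.prime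
        H.finrank (S.w v) (S.y v) (S.y_not_mem_range H v) hyp hw
    · exact CleanResolves.isRegularLocalRing_integralClosure_of_transversal (K := V.functionField)
        H.prime H.finrank (S.w v) (S.y v) (S.y_not_mem_range H v) hyp c hc1
        (fun h => hc2 (Ideal.mem_sup_left h))
  · have h1 : ∏ i, S.u v i ^ S.a v i = S.u v i₀ ^ S.a v i₀ := by
      refine Finset.prod_eq_single i₀ (fun i _ hi => by rw [hrest i hi, pow_zero]) (by simp)
    rw [h1] at hyp
    have hrs := (RoundOff.isRsopPart_u S v)
    exact isRegularLocalRing_integralClosure_of_one_charged (K := V.functionField) p H.prime H.finrank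
      (S.u v i₀) (S.w v) (hrs.mem_maximalIdeal i₀) (hrs.not_mem_sq i₀) (S.isUnit_w v) (S.a v i₀)
      ((S.a_spec v i₀).resolve_left hi₀) (S.y v) (S.y_not_mem_range H v) hyp

end Presentation

end GameState

/-- The toroidal locus of a game state (explicit-binder form, the registered interface of this
helper file). [folklore] -/
theorem gameState_mem_tor_iff {p : ℕ} {V₀ : Scheme.{0}} [IsIntegral V₀] {L : Type} [Field L]
    [Algebra V₀.functionField L] {V : Scheme.{0}} [IsIntegral V] {π : V ⟶ V₀} [IsDominant π]
    (S : GameState p V₀ L V π) (v : V) : v ∈ S.tor ↔ ∃ D, S.chargedAt D v :=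
  Iff.rfl

end Summit.ResolutionOfSingularities.ResolutionOfSingularities.Theorems.RadicialJung.CleanModelsSuffice

end
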